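import Summits.CriticalPhenomena.PercolationContinuityZ3.Theorems.SahiMasterFamilySparseEndUnionClosed

/-!
# The principal-cap dichotomy, I: abstract facts about the signed partition sum of a union-closed family

Support file of the master-family programme (crux `NoHeavyLowerTail`, stmt-CriticalPhenomena-4575; cell `prim-masterthm`, seat P4,
unit `prim-masterthm-p4-g6`).  Seat document HOME/prim-masterthm-p4/PROOF-PCD.md §1.  Pure finite combinatorics, continuing
`SahiMasterFamilySparseEnd{Partitions, All, UnionClosed}` (`parts`, `Z`, `N = −Z`, `Z_rec`, `Z_insert`, `Z_nonpos`).

For a family `Q` of subsets closed under pairwise unions (weights `b ≥ 1`):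
* `biUnion_mem_of_unionClosed` — the union of a nonempty subfamily is a member;
* `Z_nonpos_of_unionClosed` — `Z_Q(Y) ≤ 0` for EVERY nonempty `Y` (no hypothesis `Y ∈ Q` or `Q ⊆ 2^Y`);
* `unionClosed_insert` — adjoining a set absorbing or closing all unions keeps union-closure;
* **`Z_mono_family`** (ANTITONICITY, PROOF-PCD (1a)): `Q ⊆ Q''` both union-closed, `X ∈ Q`, members of `Q''` nonempty subsets of `X`
  `⟹ Z_Q(X) ≤ Z_{Q''}(X)`, i.e. `N_{Q''} ≤ N_Q` (adjoin a largest missing member at a time; `Z_insert`);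
* **`Z_sdiff_singleton_eq_zero`** (RESTRICTION LEMMA, PROOF-PCD (1c)): `Z_Q(X) = 0`, `{x} ∉ Q ⟹ Z_Q(X ∖ {x}) = 0` (adjoin the largest
  non-member containing `x`; induction on the number of non-members);
* `Z_singleton` — `Z_Q({x}) = −(b_x − 1)!·[{x} ∈ Q]`;
* `Z_image_of_injective` — `Z` (unit weights) is invariant under relabelling the ground set along an injection.
HONEST FRAMING: elementary; [this work].  Used by the KeyStep / PCD files; nothing here bears on `C_n` [Sahi2008, Conj. 5].
-/

namespace Summit.CriticalPhenomena.PercolationContinuityZ3.Theorems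

namespace SahiSparseEnd

open Finset

variable {α : Type*} [DecidableEq α]

/-! ### Union-closed families: small tools -/

/-- In a union-closed family, the union of a nonempty subfamily is a member. [this work] -/
theorem biUnion_mem_of_unionClosed {Q : Finset (Finset α)} (hQ : ∀ A ∈ Q, ∀ B ∈ Q, A ∪ B ∈ Q) :
    ∀ R : Finset (Finset α), R ⊆ Q → R.Nonempty → R.biUnion id ∈ Q := by
  intro R
  induction R using Finset.induction_on with
  | empty => intro _ h; exact absurd h (by simp)
  | insert A R hA ihR =>
    intro hR _
    rcases R.eq_empty_or_nonempty with hRe | hRne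
    · rw [hRe, insert_empty, singleton_biUnion, id]
      exact hR (mem_insert_self _ _)
    · rw [biUnion_insert, id]
      exact hQ _ (hR (mem_insert_self _ _)) _ (ihR ((subset_insert _ _).trans hR) hRne)

/-- `Z_Q(Y) ≤ 0` for every nonempty `Y` when `Q` is closed under unions (if `Y ∉ Q` it is `0`, else restrict `Q` to `2^Y`).
[this work] -/
theorem Z_nonpos_of_unionClosed {Q : Finset (Finset α)} (hQ : ∀ A ∈ Q, ∀ B ∈ Q, A ∪ B ∈ Q) {b : α → ℕ}
    (hb : ∀ x, 1 ≤ b x) {Y : Finset α} (hY : Y.Nonempty) : Z Q b Y ≤ 0 := by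
  by_cases hYQ : Y ∈ Q
  · rw [Z_restrict]
    refine Z_nonpos b hb Y.card Y rfl hY (Q.filter fun B => B ⊆ Y) (fun B hB => mem_powerset.2 (mem_filter.1 hB).2) ?_
      (mem_filter.2 ⟨hYQ, subset_rfl⟩)
    intro A hA B hB
    rw [mem_filter] at hA hB ⊢
    exact ⟨hQ A hA.1 B hB.1, union_subset hA.2 hB.2⟩
  · exact (Z_eq_zero_of_not_mem hQ b hY hYQ).le

omit [DecidableEq α] in
/-- The block weight is positive. [this work] -/
theorem bw_pos (b : α → ℕ) (A : Finset α) : 0 < bw b A := by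
  unfold bw; exact_mod_cast Nat.factorial_pos _

/-- Adjoining a set `A` such that every union `A ∪ C` (`C ∈ Q`) is `A` or a member keeps union-closure. [this work] -/
theorem unionClosed_insert {Q : Finset (Finset α)} (hQ : ∀ A ∈ Q, ∀ B ∈ Q, A ∪ B ∈ Q) {A : Finset α}
    (hA : ∀ C ∈ Q, A ∪ C = A ∨ A ∪ C ∈ Q) : ∀ B ∈ insert A Q, ∀ C ∈ insert A Q, B ∪ C ∈ insert A Q := by
  intro B hB C hC
  rcases mem_insert.1 hB with hBA | hB <;> rcases mem_insert.1 hC with hCA | hC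
  · rw [hBA, hCA, union_self]; exact mem_insert_self _ _
  · rw [hBA]
    rcases hA C hC with h | h
    · rw [h]; exact mem_insert_self _ _
    · exact mem_insert_of_mem h
  · rw [hCA, union_comm]
    rcases hA B hB with h | h
    · rw [h]; exact mem_insert_self _ _
    · exact mem_insert_of_mem h
  · exact mem_insert_of_mem (hQ B hB C hC)

/-! ### Antitonicity in the family -/

/-- **ANTITONICITY (PROOF-PCD (1a)).**  For union-closed families `Q ⊆ Q''` of nonempty subsets of `X` with `X ∈ Q` and weights
`b ≥ 1`: `Z_Q(X) ≤ Z_{Q''}(X)`, i.e. `N_{Q''}(b; X) ≤ N_Q(b; X)`. [this work] -/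
theorem Z_mono_family {b : α → ℕ} (hb : ∀ x, 1 ≤ b x) {X : Finset α} :
    ∀ (m : ℕ) (Q Q'' : Finset (Finset α)), (Q'' \ Q).card = m → Q ⊆ Q'' → Q'' ⊆ X.powerset → (∀ A ∈ Q'', A.Nonempty) →
      (∀ A ∈ Q, ∀ B ∈ Q, A ∪ B ∈ Q) → (∀ A ∈ Q'', ∀ B ∈ Q'', A ∪ B ∈ Q'') → X ∈ Q → Z Q b X ≤ Z Q'' b X := by
  intro m
  induction m using Nat.strong_induction_on with
  | _ m ih =>
    intro Q Q'' hm hQQ hQX h0 hQ hQ'' hXQ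
    rcases Nat.eq_zero_or_pos m with hm0 | hmpos
    · have hsub : Q'' ⊆ Q := by
        intro A hA
        by_contra hAQ
        have hmem : A ∈ Q'' \ Q := mem_sdiff.2 ⟨hA, hAQ⟩
        rw [hm0] at hm
        exact absurd (card_pos.2 ⟨A, hmem⟩) (by omega)
      rw [subset_antisymm hQQ hsub]
    · obtain ⟨A, hAmem, hAmax⟩ := exists_max_image (Q'' \ Q) Finset.card (card_pos.1 (by omega))
      obtain ⟨hAQ'', hAQ⟩ := mem_sdiff.1 hAmem
      have hAX : A ⊆ X := mem_powerset.1 (hQX hAQ'')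
      have hAne : A.Nonempty := h0 A hAQ''
      -- `insert A Q` is union-closed: a union `A ∪ C` outside `Q` is a missing member at least as large as `A`
      have hins : ∀ B ∈ insert A Q, ∀ C ∈ insert A Q, B ∪ C ∈ insert A Q := by
        refine unionClosed_insert hQ fun C hC => ?_
        by_cases h : A ∪ C ∈ Q
        · exact Or.inr h
        · left
          have hmem : A ∪ C ∈ Q'' \ Q := mem_sdiff.2 ⟨hQ'' A hAQ'' C (hQQ hC), h⟩
          exact (eq_of_subset_of_card_le subset_union_left (hAmax _ hmem)).symm
      have hm' : (Q'' \ insert A Q).card < m := by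
        rw [← hm]
        refine card_lt_card (Finset.ssubset_iff_subset_ne.2 ⟨sdiff_subset_sdiff subset_rfl (subset_insert _ _), fun e => ?_⟩)
        have hmem : A ∈ Q'' \ insert A Q := by rw [e]; exact hAmem
        exact (mem_sdiff.1 hmem).2 (mem_insert_self _ _)
      have h1 := ih _ hm' (insert A Q) Q'' rfl (insert_subset hAQ'' hQQ) hQX h0 hins hQ'' (mem_insert_of_mem hXQ)
      rw [Z_insert hAX hAne hAQ] at h1
      have hXA : (X \ A).Nonempty := sdiff_nonempty.2 fun h => hAQ (by rw [subset_antisymm hAX h]; exact hXQ)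
      have h2 : Z Q b (X \ A) ≤ 0 := Z_nonpos_of_unionClosed hQ hb hXA
      have hbw : (0 : ℤ) ≤ bw b A := (bw_pos b A).le
      nlinarith

/-- Antitonicity, headline form: `N_{Q''} ≤ N_Q`. [this work] -/
theorem N_antitone {b : α → ℕ} (hb : ∀ x, 1 ≤ b x) {X : Finset α} {Q Q'' : Finset (Finset α)} (hQQ : Q ⊆ Q'')
    (hQX : Q'' ⊆ X.powerset) (h0 : ∀ A ∈ Q'', A.Nonempty) (hQ : ∀ A ∈ Q, ∀ B ∈ Q, A ∪ B ∈ Q)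
    (hQ'' : ∀ A ∈ Q'', ∀ B ∈ Q'', A ∪ B ∈ Q'') (hXQ : X ∈ Q) : N Q'' b X ≤ N Q b X := by
  rw [N_eq_neg_Z, N_eq_neg_Z]
  have := Z_mono_family hb _ Q Q'' rfl hQQ hQX h0 hQ hQ'' hXQ
  linarith

/-! ### The restriction lemma -/

/-- **RESTRICTION LEMMA (PROOF-PCD (1c)).**  For a union-closed family `Q` of subsets of `X` with `X ∈ Q`, weights `b ≥ 1`, and a point
`x ∈ X` with `{x} ∉ Q`: if `Z_Q(X) = 0` then `Z_Q(X ∖ {x}) = 0`. [this work] -/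
theorem Z_sdiff_singleton_eq_zero {b : α → ℕ} (hb : ∀ x, 1 ≤ b x) {X : Finset α} {x : α} (hx : x ∈ X) :
    ∀ (m : ℕ) (Q : Finset (Finset α)), (X.powerset.filter fun A => A.Nonempty ∧ A ∉ Q).card = m →
      Q ⊆ X.powerset → (∀ A ∈ Q, ∀ B ∈ Q, A ∪ B ∈ Q) → X ∈ Q → {x} ∉ Q → Z Q b X = 0 → Z Q b (X \ {x}) = 0 := by
  intro m
  induction m using Nat.strong_induction_on with
  | _ m ih =>
    intro Q hm hQX hQ hXQ hxQ hZ
    -- a largest non-member containing `x` (there is one: `{x}`)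
    have hxNM : ({x} : Finset α) ∈ X.powerset.filter fun A => x ∈ A ∧ A ∉ Q :=
      mem_filter.2 ⟨mem_powerset.2 (singleton_subset_iff.2 hx), mem_singleton_self x, hxQ⟩
    obtain ⟨A, hAmem, hAmax⟩ := exists_max_image (X.powerset.filter fun A => x ∈ A ∧ A ∉ Q) Finset.card ⟨{x}, hxNM⟩
    rw [mem_filter, mem_powerset] at hAmem
    obtain ⟨hAX, hxA, hAQ⟩ := hAmem
    have hAne : A.Nonempty := ⟨x, hxA⟩
    have hins : ∀ B ∈ insert A Q, ∀ C ∈ insert A Q, B ∪ C ∈ insert A Q := by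
      refine unionClosed_insert hQ fun C hC => ?_
      by_cases h : A ∪ C ∈ Q
      · exact Or.inr h
      · left
        have hmem : A ∪ C ∈ X.powerset.filter fun A' => x ∈ A' ∧ A' ∉ Q :=
          mem_filter.2 ⟨mem_powerset.2 (union_subset hAX (mem_powerset.1 (hQX hC))), mem_union_left _ hxA, h⟩
        exact (eq_of_subset_of_card_le subset_union_left (hAmax _ hmem)).symm
    -- `0 = Z_Q(X)`, `Z_{Q+A}(X) = Z_Q(X) − (b_A−1)!·Z_Q(X∖A)` with both `Z`'s `≤ 0`: both vanish
    have hXA : (X \ A).Nonempty := sdiff_nonempty.2 fun h => hAQ (by rw [subset_antisymm hAX h]; exact hXQ)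
    have e := Z_insert (Q := Q) (b := b) hAX hAne hAQ
    rw [hZ, zero_add] at e
    have h1 : Z (insert A Q) b X ≤ 0 :=
      Z_nonpos b hb X.card X rfl ⟨x, hx⟩ (insert A Q) (insert_subset (mem_powerset.2 hAX) hQX) hins (mem_insert_of_mem hXQ)
    have h2 : Z Q b (X \ A) ≤ 0 := Z_nonpos_of_unionClosed hQ hb hXA
    have hbw : (0 : ℤ) < bw b A := bw_pos b A
    have h4 : 0 ≤ bw b A * Z Q b (X \ A) := by linarith
    have h2' : Z Q b (X \ A) = 0 := le_antisymm h2 (by nlinarith)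
    have h1' : Z (insert A Q) b X = 0 := by rw [e, h2', mul_zero]
    by_cases hA1 : A = {x}
    · rw [← hA1]; exact h2'
    · -- adjoin `A` and induct: `{x}` is still missing, and the restrictions to `2^{X∖x}` agree since `x ∈ A`
      have hm' : (X.powerset.filter fun A' => A'.Nonempty ∧ A' ∉ insert A Q).card < m := by
        rw [← hm]
        refine card_lt_card (Finset.ssubset_iff_subset_ne.2 ⟨fun B hB => ?_, fun e' => ?_⟩)
        · rw [mem_filter] at hB ⊢
          exact ⟨hB.1, hB.2.1, fun h => hB.2.2 (mem_insert_of_mem h)⟩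
        · have hmem : A ∈ X.powerset.filter fun A' => A'.Nonempty ∧ A' ∉ insert A Q := by
            rw [e']; exact mem_filter.2 ⟨mem_powerset.2 hAX, hAne, hAQ⟩
          exact (mem_filter.1 hmem).2.2 (mem_insert_self _ _)
      have hxQ' : ({x} : Finset α) ∉ insert A Q := fun h => by
        rcases mem_insert.1 h with h | h
        · exact hA1 h.symm
        · exact hxQ h
      have h3 := ih _ hm' (insert A Q) rfl (insert_subset (mem_powerset.2 hAX) hQX) hins (mem_insert_of_mem hXQ) hxQ' h1'
      rw [Z_restrict] at h3
      rw [Z_restrict]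
      have hfilt : (Q.filter fun B => B ⊆ X \ {x}) = (insert A Q).filter fun B => B ⊆ X \ {x} := by
        ext B
        simp only [mem_filter, mem_insert]
        constructor
        · rintro ⟨hB, hBX⟩; exact ⟨Or.inr hB, hBX⟩
        · rintro ⟨hB | hB, hBX⟩
          · exfalso
            have hx' : x ∈ X \ {x} := hBX (hB ▸ hxA)
            rw [mem_sdiff, mem_singleton] at hx'
            exact hx'.2 rfl
          · exact ⟨hB, hBX⟩
      rw [hfilt]
      exact h3

/-- The restriction lemma, headline form (`N`). [this work] -/
theorem N_sdiff_singleton_eq_zero {b : α → ℕ} (hb : ∀ x, 1 ≤ b x) {X : Finset α} {Q : Finset (Finset α)}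
    (hQX : Q ⊆ X.powerset) (hQ : ∀ A ∈ Q, ∀ B ∈ Q, A ∪ B ∈ Q) (hXQ : X ∈ Q) {x : α} (hx : x ∈ X) (hxQ : {x} ∉ Q)
    (hN : N Q b X = 0) : N Q b (X \ {x}) = 0 := by
  rw [N_eq_neg_Z, neg_eq_zero] at hN ⊢
  exact Z_sdiff_singleton_eq_zero hb hx _ Q rfl hQX hQ hXQ hxQ hN

/-! ### One-point ground sets and relabelling -/

/-- `Z_Q({x}) = −(b_x − 1)!` if `{x} ∈ Q`, else `0`. [this work] -/
theorem Z_singleton (Q : Finset (Finset α)) (b : α → ℕ) (x : α) :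
    Z Q b {x} = if {x} ∈ Q then -bw b {x} else 0 := by
  rw [Z_rec Q b (mem_singleton_self x), sum_filter]
  have hp : ({x} : Finset α).powerset = {∅, {x}} := by
    ext T; rw [mem_powerset, subset_singleton_iff, mem_insert, mem_singleton]
  rw [hp, sum_pair (singleton_ne_empty x).symm, if_neg (fun h => notMem_empty x h.1), zero_add, Finset.sdiff_self, Z_empty,
    mul_one]
  by_cases h : ({x} : Finset α) ∈ Q
  · rw [if_pos ⟨mem_singleton_self x, h⟩, if_pos h]
  · rw [if_neg (fun h' => h h'.2), if_neg h]

omit [DecidableEq α] in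
/-- The block weight at unit weights: `(|T| − 1)!`. [this work] -/
theorem bw_one (T : Finset α) : bw (fun _ => 1) T = (((T.card - 1).factorial : ℕ) : ℤ) := by
  rw [bw, sum_const, smul_eq_mul, mul_one]

/-- **Relabelling invariance**: for an injective `f`, `Z_{f(Q)}(f(X)) = Z_Q(X)` at unit weights. [this work] -/
theorem Z_image_of_injective {β : Type*} [DecidableEq β] {f : α → β} (hf : Function.Injective f) (Q : Finset (Finset α)) :
    ∀ (n : ℕ) (X : Finset α), X.card = n → Z (Q.image (Finset.image f)) (fun _ => 1) (X.image f) = Z Q (fun _ => 1) X := by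
  intro n
  induction n using Nat.strong_induction_on with
  | _ n ih =>
    intro X hXn
    rcases X.eq_empty_or_nonempty with hXe | ⟨s, hs⟩
    · rw [hXe, image_empty, Z_empty, Z_empty]
    · rw [Z_rec Q _ hs, Z_rec _ _ (mem_image_of_mem f hs)]
      symm
      -- the index sets correspond under `T ↦ f(T)`; the inverse is `T' ↦ {y ∈ X : f y ∈ T'}`
      have key : ∀ T' ∈ (X.image f).powerset.filter (fun T' => f s ∈ T' ∧ T' ∈ Q.image (Finset.image f)),
          (X.filter fun y => f y ∈ T') ∈ Q ∧ (X.filter fun y => f y ∈ T').image f = T' := by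
        intro T' hT'
        rw [mem_filter, mem_powerset] at hT'
        obtain ⟨hT'X, -, hT'Q⟩ := hT'
        obtain ⟨T, hTQ, rfl⟩ := mem_image.1 hT'Q
        have hTX : T ⊆ X := fun y hy => by
          obtain ⟨y', hy', hyy'⟩ := mem_image.1 (hT'X (mem_image_of_mem f hy))
          rwa [← hf hyy']
        have hfilt : (X.filter fun y => f y ∈ T.image f) = T := by
          ext y
          rw [mem_filter, mem_image]
          constructor
          · rintro ⟨-, y', hy', hyy'⟩; rwa [← hf hyy']
          · intro hy; exact ⟨hTX hy, y, hy, rfl⟩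
        rw [hfilt]
        exact ⟨hTQ, rfl⟩
      refine sum_nbij' (fun T => T.image f) (fun T' => X.filter fun y => f y ∈ T') ?_ ?_ ?_ ?_ ?_
      · intro T hT
        rw [mem_filter, mem_powerset] at hT ⊢
        exact ⟨image_subset_image hT.1, mem_image_of_mem f hT.2.1, mem_image_of_mem _ hT.2.2⟩
      · intro T' hT'
        have hk := key T' hT'
        have hT'' := mem_filter.1 hT'
        rw [mem_filter, mem_powerset]
        refine ⟨filter_subset _ _, mem_filter.2 ⟨hs, hT''.2.1⟩, hk.1⟩
      · intro T hT
        rw [mem_filter, mem_powerset] at hT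
        ext y
        rw [mem_filter, mem_image]
        constructor
        · rintro ⟨-, y', hy', hyy'⟩; rwa [← hf hyy']
        · intro hy; exact ⟨hT.1 hy, y, hy, rfl⟩
      · intro T' hT'
        exact (key T' hT').2
      · intro T hT
        rw [mem_filter, mem_powerset] at hT
        have hTne : T.Nonempty := ⟨s, hT.2.1⟩
        rw [bw_one, bw_one, card_image_of_injective _ hf, ← image_sdiff _ _ hf,
          ih _ (by rw [← hXn]; exact card_lt_card (sdiff_ssubset hT.1 hTne)) (X \ T) rfl]

/-- Relabelling invariance for `N` at unit weights. [this work] -/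
theorem N_image_of_injective {β : Type*} [DecidableEq β] {f : α → β} (hf : Function.Injective f) (Q : Finset (Finset α))
    (X : Finset α) : N (Q.image (Finset.image f)) (fun _ => 1) (X.image f) = N Q (fun _ => 1) X := by
  rw [N_eq_neg_Z, N_eq_neg_Z, Z_image_of_injective hf Q _ X rfl]

end SahiSparseEnd

end Summit.CriticalPhenomena.PercolationContinuityZ3.Theorems
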